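import Literature.NumberTheory.Automorphic.UnitaryGroupTransferAwayOff
import Literature.NumberTheory.Rogawski1990.TestFunctionsNonempty
import HarnessLib

/-!
# Every smooth pure tensor on `U(H)(𝔸)` has a smooth TRANSFER PARTNER on `U(H′)(𝔸)` along local identifications given only OFF a finite
# set `S` (`GlobalTransferAwayOff`); the rank-2 letter's transfer pins are satisfiable
(Rogawski, *Automorphic representations of unitary groups in three variables* (1990), §14.2 p. 233)

Topic `NumberTheory/Automorphic`; namespace `Literature.NumberTheory.Automorphic.UnitaryGroup`.  THEOREMS ONLY (no definition, no named fact, no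
`sorry`, no instance, no notation).  Sequel of ★ `UnitaryGroupTransferAwayOff` (`GlobalTransferAwayOff S ψ S₀ f′ f` for a family
`ψ : ∀ v, v ∉ S → U(H)(L⁺_v) ≃ₜ* U(H′)(L⁺_v)`, its non-vacuity, and the rank-2 supply `exists_psiOff_conj_forall_levelMatching_two`) — the
partial-family twin of ★ `UnitaryGroupTransferAwayPartner` (total `ψ`, rank 3).

* `exists_globalTransferAwayOff_ne_zero_ne_zero` — non-vacuity with BOTH `f′ ≠ 0` and `f ≠ 0` (F0P3a-ref1 R1-149 n1);
* `PureTensor.exists_isTest_forall_loc_eq_comp_symm_off` — for `ψ v hv` matching the integral levels off `S ∪ S₀` and an unramified finitely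
  smooth pure tensor `T` on `U(H)`: a pure tensor `T′` on `U(H′)` with `T′.IsTest`, bad set `S ∪ S₀ ∪ T.S`, `T′.loc v = T.loc v ∘ (ψ v hv)⁻¹`
  at every `v ∉ S`, and `T′.loc v = 1_{U(H′)(𝒪_v)}` at `v ∈ S` (there is no identification at `S`; any smooth factor does — the honest
  over-approximation of [Rogawski1990, §14.2 p. 233] «`f_v := f′_v`» away from `S₀ ∪ S`, the transfer-factor layer at `S` being elsewhere);
* `exists_isTest_globalTransferAwayOff_of_isTest`, `exists_smooth_globalTransferAwayOff_of_smooth` — hence every smooth `f′` has a smooth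
  partner `f` with `GlobalTransferAwayOff S ψ S₀ f′ f`;
* **`exists_psiOff_globalTransferAwayOff_satisfiable_two`** — RANK 2 (`H ∈ M₂(L)` hermitian, `det H ≠ 0`): with `S = T` (the anisotropic set),
  the family `ψ` off `S` and `S₀ ⊇ S` of ★ `exists_psiOff_conj_forall_levelMatching_two`, smooth `f′ ≠ 0` exist and every smooth `f′` has a
  smooth partner — the twin of ★ `exists_psi_globalTransferAway_satisfiable` (rank 3), i.e. the satisfiability of the `N = 2` letter's pins
  (iv) + (vi) + T1g(2,H) (i) for `Transfer := GlobalTransferAwayOff S ψ S₀`.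

Cell `hodgecm-mathlib`, `N = 2` edition of ENGINE T1 (F0P5-plan (g2) desk word #12; SPEC-ed1.19c §7).  HC_CM is proved only modulo the printed
citations until rung 0 closes; this file is unconditional.

## References
* [Rogawski1990] J. Rogawski, Ann. of Math. Stud. 123 (1990), §14.2 p. 233.
* [BorelJacquet1979] A. Borel, H. Jacquet, PSPM 33.1 (1979), §4.1.
-/

set_option autoImplicit false

noncomputable section

open NumberField IsDedekindDomain Filter Set
open scoped Classical Matrix MatrixGroups

namespace Literature.NumberTheory.Automorphic.UnitaryGroup

variable (L : Type) [Field L] [NumberField L] [IsCMField L] (N : ℕ)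

section Partner

variable {H H' : Matrix (Fin N) (Fin N) L}

/-- **Non-vacuity with BOTH sides non-zero** (F0P3a-ref1 (g3) R1-149 n1): if the `ψ v hv` match the integral levels off `S ∪ S₀`, the unit tensors
`φ_∞ ⊗ ⊗_v 1_{U(H)(𝒪_v)}` and `φ′_∞ ⊗ ⊗_v 1_{U(H′)(𝒪_v)}` (bumps with `φ(1) = φ′(1) = 1`, ★ `exists_arch_bump`) give `f′ ≠ 0` AND `f ≠ 0` with
`GlobalTransferAwayOff S ψ S₀ f′ f` — strengthens ★ `exists_globalTransferAwayOff_ne_zero` (which records `f′ ≠ 0` only).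
[cite: Rogawski1990, §14.2 p. 233] -/
theorem exists_globalTransferAwayOff_ne_zero_ne_zero (S : Finset (HeightOneSpectrum (𝓞 ↥(maximalRealSubfield L))))
    (ψ : ∀ v : HeightOneSpectrum (𝓞 ↥(maximalRealSubfield L)), v ∉ S → ((cmDatum L N H).Local v ≃ₜ* (cmDatum L N H').Local v))
    (S₀ : Finset (HeightOneSpectrum (𝓞 ↥(maximalRealSubfield L))))
    (hψ : ∀ (v : HeightOneSpectrum (𝓞 ↥(maximalRealSubfield L))) (hv : v ∉ S), v ∉ S₀ →
      ∀ g, ψ v hv g ∈ cmLocalIntegralLevel L N H' v ↔ g ∈ cmLocalIntegralLevel L N H v) :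
    ∃ (f' : CompactlySupportedContinuousMap (cmDatum L N H).Adelic ℂ)
      (f : CompactlySupportedContinuousMap (cmDatum L N H').Adelic ℂ), f' ≠ 0 ∧ f ≠ 0 ∧ GlobalTransferAwayOff L N S ψ S₀ f' f := by
  obtain ⟨φ, hφ, hφc, hφ1⟩ := exists_arch_bump L H
  obtain ⟨φ', hφ', hφ'c, hφ'1⟩ := exists_arch_bump L H'
  let T : PureTensor L N H := PureTensor.unit L H fun g => (φ g : ℂ)
  let T' : PureTensor L N H' := PureTensor.unit L H' fun g => (φ' g : ℂ)
  have hK : ∀ v ∉ T.S, T.K v = cmLocalIntegralLevel L N H v := fun _ _ => rfl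
  have hK' : ∀ v ∉ T'.S, T'.K v = cmLocalIntegralLevel L N H' v := fun _ _ => rfl
  have ha : Continuous T.arch := Complex.continuous_ofReal.comp hφ
  have ha' : Continuous T'.arch := Complex.continuous_ofReal.comp hφ'
  have hac : HasCompactSupport T.arch := hφc.comp_left Complex.ofReal_zero
  have hac' : HasCompactSupport T'.arch := hφ'c.comp_left Complex.ofReal_zero
  have hl : ∀ v ∈ T.S, Continuous (T.loc v) := fun v hv => absurd hv (Finset.notMem_empty v)
  have hl' : ∀ v ∈ T'.S, Continuous (T'.loc v) := fun v hv => absurd hv (Finset.notMem_empty v)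
  have hlc : ∀ v ∈ T.S, HasCompactSupport (T.loc v) := fun v hv => absurd hv (Finset.notMem_empty v)
  have hlc' : ∀ v ∈ T'.S, HasCompactSupport (T'.loc v) := fun v hv => absurd hv (Finset.notMem_empty v)
  refine ⟨T.toCc hK ha hac hl hlc, T'.toCc hK' ha' hac' hl' hlc', fun h0 => ?_, fun h0 => ?_, T, T', rfl, rfl, fun v hvS hv => ?_⟩
  · have h1 : T.eval 1 = 1 := by
      rw [show T = PureTensor.unit L H fun g => (φ g : ℂ) from rfl, PureTensor.unit_eval_one, hφ1, Complex.ofReal_one]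
    have h := DFunLike.congr_fun h0 (1 : (cmDatum L N H).Adelic)
    rw [PureTensor.toCc_apply, CompactlySupportedContinuousMap.zero_apply, h1] at h
    exact one_ne_zero h
  · have h1 : T'.eval 1 = 1 := by
      rw [show T' = PureTensor.unit L H' fun g => (φ' g : ℂ) from rfl, PureTensor.unit_eval_one, hφ'1, Complex.ofReal_one]
    have h := DFunLike.congr_fun h0 (1 : (cmDatum L N H').Adelic)
    rw [PureTensor.toCc_apply, CompactlySupportedContinuousMap.zero_apply, h1] at h
    exact one_ne_zero h
  · have hv₀ : v ∉ S₀ := by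
      simp only [Finset.union_empty, show T.S = ∅ from rfl, show T'.S = ∅ from rfl] at hv
      exact hv
    funext k'
    change ((cmLocalIntegralLevel L N H' v : Set ((cmDatum L N H').Local v))).indicator (fun _ => (1 : ℂ)) k' =
      ((cmLocalIntegralLevel L N H v : Set ((cmDatum L N H).Local v))).indicator (fun _ => (1 : ℂ)) ((ψ v hvS).symm k')
    by_cases hk : k' ∈ cmLocalIntegralLevel L N H' v
    · have hk' : (ψ v hvS).symm k' ∈ cmLocalIntegralLevel L N H v :=
        (hψ v hvS hv₀ _).1 (by rw [ContinuousMulEquiv.apply_symm_apply]; exact hk)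
      rw [Set.indicator_of_mem (show k' ∈ (cmLocalIntegralLevel L N H' v : Set _) from hk),
        Set.indicator_of_mem (show (ψ v hvS).symm k' ∈ (cmLocalIntegralLevel L N H v : Set _) from hk')]
    · have hk' : (ψ v hvS).symm k' ∉ cmLocalIntegralLevel L N H v := fun h =>
        hk (by have h' := (hψ v hvS hv₀ _).2 h; rwa [ContinuousMulEquiv.apply_symm_apply] at h')
      rw [Set.indicator_of_notMem (show k' ∉ (cmLocalIntegralLevel L N H' v : Set _) from hk),
        Set.indicator_of_notMem (show (ψ v hvS).symm k' ∉ (cmLocalIntegralLevel L N H v : Set _) from hk')]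

/-- **The transfer partner along a family defined off `S`.**  `ψ v hv` matching the integral levels for `v ∉ S ∪ S₀`, `T` an unramified
finitely-smooth pure tensor on `U(H)`: there is `T′` on `U(H′)` with `T′.IsTest`, `T′.S = S ∪ S₀ ∪ T.S`, `T′.loc v = T.loc v ∘ (ψ v hv)⁻¹` at
every `v ∉ S`, and `T′.loc v = 1_{U(H′)(𝒪_v)}` at `v ∈ S` (no identification there: any smooth factor will do; the transfer-factor layer at
`S` is elsewhere).  Twin of ★ `PureTensor.exists_isTest_forall_loc_eq_comp_symm`. [cite: Rogawski1990, §14.2 p. 233] -/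
theorem PureTensor.exists_isTest_forall_loc_eq_comp_symm_off (S : Finset (HeightOneSpectrum (𝓞 ↥(maximalRealSubfield L))))
    (ψ : ∀ v : HeightOneSpectrum (𝓞 ↥(maximalRealSubfield L)), v ∉ S → ((cmDatum L N H).Local v ≃ₜ* (cmDatum L N H').Local v))
    (S₀ : Finset (HeightOneSpectrum (𝓞 ↥(maximalRealSubfield L))))
    (hψ : ∀ (v : HeightOneSpectrum (𝓞 ↥(maximalRealSubfield L))) (hv : v ∉ S), v ∉ S₀ →
      ∀ g, ψ v hv g ∈ cmLocalIntegralLevel L N H' v ↔ g ∈ cmLocalIntegralLevel L N H v)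
    (T : PureTensor L N H) (hT : T.IsUnramified) (hS : T.IsFinSmooth) :
    ∃ T' : PureTensor L N H', T'.IsTest ∧ T'.S = S ∪ S₀ ∪ T.S ∧
      (∀ (v : HeightOneSpectrum (𝓞 ↥(maximalRealSubfield L))) (hv : v ∉ S), T'.loc v = T.loc v ∘ (ψ v hv).symm) ∧
      ∀ v ∈ S, T'.loc v = (cmLocalIntegralLevel L N H' v : Set ((cmDatum L N H').Local v)).indicator fun _ => 1 := by
  obtain ⟨φ, hφc, hφs, hφsm, -⟩ := exists_archBump L N
  -- level matching turns `1_{U(H)(𝒪_v)} ∘ (ψ v hv)⁻¹` into `1_{U(H′)(𝒪_v)}` off `S ∪ S₀`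
  have hind : ∀ (v : HeightOneSpectrum (𝓞 ↥(maximalRealSubfield L))) (hv : v ∉ S), v ∉ S₀ →
      ((cmLocalIntegralLevel L N H v : Set ((cmDatum L N H).Local v)).indicator fun _ => (1 : ℂ)) ∘ (ψ v hv).symm =
        (cmLocalIntegralLevel L N H' v : Set ((cmDatum L N H').Local v)).indicator fun _ => (1 : ℂ) := by
    intro v hvS hv₀
    funext k'
    change ((cmLocalIntegralLevel L N H v : Set ((cmDatum L N H).Local v))).indicator (fun _ => (1 : ℂ)) ((ψ v hvS).symm k') =
      ((cmLocalIntegralLevel L N H' v : Set ((cmDatum L N H').Local v))).indicator (fun _ => (1 : ℂ)) k'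
    by_cases hk : k' ∈ cmLocalIntegralLevel L N H' v
    · have hk' : (ψ v hvS).symm k' ∈ cmLocalIntegralLevel L N H v :=
        (hψ v hvS hv₀ _).1 (by rw [ContinuousMulEquiv.apply_symm_apply]; exact hk)
      rw [Set.indicator_of_mem (show k' ∈ (cmLocalIntegralLevel L N H' v : Set _) from hk),
        Set.indicator_of_mem (show (ψ v hvS).symm k' ∈ (cmLocalIntegralLevel L N H v : Set _) from hk')]
    · have hk' : (ψ v hvS).symm k' ∉ cmLocalIntegralLevel L N H v := fun h =>
        hk (by have h' := (hψ v hvS hv₀ _).2 h; rwa [ContinuousMulEquiv.apply_symm_apply] at h')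
      rw [Set.indicator_of_notMem (show k' ∉ (cmLocalIntegralLevel L N H' v : Set _) from hk),
        Set.indicator_of_notMem (show (ψ v hvS).symm k' ∉ (cmLocalIntegralLevel L N H v : Set _) from hk')]
  -- the unit tensor on `U(H′)` supplies the smoothness of the indicator factors at `v ∈ S`
  have hU : (PureTensor.unit L H' fun _ => (0 : ℂ)).IsUnramified := fun _ _ => rfl
  have hUS : (PureTensor.unit L H' fun _ => (0 : ℂ)).IsFinSmooth := fun v hv => absurd hv (Finset.notMem_empty v)
  let T' : PureTensor L N H' :=
    { S := S ∪ S₀ ∪ T.S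
      K := fun v => cmLocalIntegralLevel L N H' v
      loc := fun v => if hv : v ∈ S then (cmLocalIntegralLevel L N H' v : Set ((cmDatum L N H').Local v)).indicator fun _ => 1
        else T.loc v ∘ (ψ v hv).symm
      arch := fun k => φ (k : GL (Fin N) (NumberField.mixedEmbedding.mixedSpace L))
      loc_eq_indicator := fun v hv => by
        rw [Finset.notMem_union, Finset.notMem_union] at hv
        rw [dif_neg hv.1.1, hT.loc_eq hv.2, hind v hv.1.1 hv.1.2] }
  refine ⟨T', ⟨fun _ _ => rfl, fun v _ => ⟨?_, ?_⟩, ⟨φ, hφc, hφs, hφsm, fun _ => rfl⟩⟩, rfl, fun v hv => ?_, fun v hv => ?_⟩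
  · change IsLocallyConstant (if hv : v ∈ S then (cmLocalIntegralLevel L N H' v : Set ((cmDatum L N H').Local v)).indicator
      (fun _ => (1 : ℂ)) else T.loc v ∘ (ψ v hv).symm)
    by_cases hvS : v ∈ S
    · rw [dif_pos hvS]
      exact PureTensor.isLocallyConstant_loc hU hUS v
    · rw [dif_neg hvS]
      exact (PureTensor.isLocallyConstant_loc hT hS v).comp_continuous (ψ v hvS).symm.continuous
  · change HasCompactSupport (if hv : v ∈ S then (cmLocalIntegralLevel L N H' v : Set ((cmDatum L N H').Local v)).indicator
      (fun _ => (1 : ℂ)) else T.loc v ∘ (ψ v hv).symm)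
    by_cases hvS : v ∈ S
    · rw [dif_pos hvS]
      exact PureTensor.hasCompactSupport_loc hU hUS v
    · rw [dif_neg hvS]
      exact (PureTensor.hasCompactSupport_loc hT hS v).comp_homeomorph (ψ v hvS).symm.toHomeomorph
  · change (if hv : v ∈ S then (cmLocalIntegralLevel L N H' v : Set ((cmDatum L N H').Local v)).indicator (fun _ => (1 : ℂ))
      else T.loc v ∘ (ψ v hv).symm) = _
    rw [dif_neg hv]
  · change (if hv : v ∈ S then (cmLocalIntegralLevel L N H' v : Set ((cmDatum L N H').Local v)).indicator (fun _ => (1 : ℂ))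
      else T.loc v ∘ (ψ v hv).symm) = _
    rw [dif_pos hv]

/-- **Every `IsTest` pure tensor has an `IsTest` transfer partner along a family off `S`**: `GlobalTransferAwayOff S ψ S₀ (T.toCc) (T′.toCc)`.
Twin of ★ `exists_isTest_globalTransferAway_of_isTest`. [cite: Rogawski1990, §14.2 p. 233] -/
theorem exists_isTest_globalTransferAwayOff_of_isTest (S : Finset (HeightOneSpectrum (𝓞 ↥(maximalRealSubfield L))))
    (ψ : ∀ v : HeightOneSpectrum (𝓞 ↥(maximalRealSubfield L)), v ∉ S → ((cmDatum L N H).Local v ≃ₜ* (cmDatum L N H').Local v))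
    (S₀ : Finset (HeightOneSpectrum (𝓞 ↥(maximalRealSubfield L))))
    (hψ : ∀ (v : HeightOneSpectrum (𝓞 ↥(maximalRealSubfield L))) (hv : v ∉ S), v ∉ S₀ →
      ∀ g, ψ v hv g ∈ cmLocalIntegralLevel L N H' v ↔ g ∈ cmLocalIntegralLevel L N H v)
    (T : PureTensor L N H) (hT : T.IsTest) :
    ∃ (T' : PureTensor L N H') (hT' : T'.IsTest),
      GlobalTransferAwayOff L N S ψ S₀
        (T.toCc hT.isUnramified hT.isArchTest.continuous_arch hT.isArchTest.hasCompactSupport_arch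
          (fun v _ => PureTensor.continuous_loc hT.isUnramified hT.isFinSmooth v)
          (fun v _ => PureTensor.hasCompactSupport_loc hT.isUnramified hT.isFinSmooth v))
        (T'.toCc hT'.isUnramified hT'.isArchTest.continuous_arch hT'.isArchTest.hasCompactSupport_arch
          (fun v _ => PureTensor.continuous_loc hT'.isUnramified hT'.isFinSmooth v)
          (fun v _ => PureTensor.hasCompactSupport_loc hT'.isUnramified hT'.isFinSmooth v)) := by
  obtain ⟨T', hT', -, hloc, -⟩ :=
    PureTensor.exists_isTest_forall_loc_eq_comp_symm_off L N S ψ S₀ hψ T hT.isUnramified hT.isFinSmooth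
  exact ⟨T', hT', T, T', rfl, rfl, fun v hv _ => hloc v hv⟩

/-- **Every SMOOTH `f′ ∈ C_c(U(H)(𝔸))` has a SMOOTH `f ∈ C_c(U(H′)(𝔸))` with `GlobalTransferAwayOff S ψ S₀ f′ f`** (kit currency:
`Smooth f ↔ ∃ T, T.IsTest ∧ ⇑f = T.eval`).  Twin of ★ `exists_smooth_globalTransferAway_of_smooth`. [cite: Rogawski1990, §14.2 p. 233] -/
theorem exists_smooth_globalTransferAwayOff_of_smooth (S : Finset (HeightOneSpectrum (𝓞 ↥(maximalRealSubfield L))))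
    (ψ : ∀ v : HeightOneSpectrum (𝓞 ↥(maximalRealSubfield L)), v ∉ S → ((cmDatum L N H).Local v ≃ₜ* (cmDatum L N H').Local v))
    (S₀ : Finset (HeightOneSpectrum (𝓞 ↥(maximalRealSubfield L))))
    (hψ : ∀ (v : HeightOneSpectrum (𝓞 ↥(maximalRealSubfield L))) (hv : v ∉ S), v ∉ S₀ →
      ∀ g, ψ v hv g ∈ cmLocalIntegralLevel L N H' v ↔ g ∈ cmLocalIntegralLevel L N H v)
    (f' : CompactlySupportedContinuousMap (cmDatum L N H).Adelic ℂ) (hf' : ∃ T : PureTensor L N H, T.IsTest ∧ ⇑f' = T.eval) :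
    ∃ f : CompactlySupportedContinuousMap (cmDatum L N H').Adelic ℂ,
      (∃ T' : PureTensor L N H', T'.IsTest ∧ ⇑f = T'.eval) ∧ GlobalTransferAwayOff L N S ψ S₀ f' f := by
  obtain ⟨T, hT, hf'T⟩ := hf'
  obtain ⟨T', hT', -, hloc, -⟩ :=
    PureTensor.exists_isTest_forall_loc_eq_comp_symm_off L N S ψ S₀ hψ T hT.isUnramified hT.isFinSmooth
  exact ⟨T'.toCc hT'.isUnramified hT'.isArchTest.continuous_arch hT'.isArchTest.hasCompactSupport_arch
      (fun v _ => PureTensor.continuous_loc hT'.isUnramified hT'.isFinSmooth v)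
      (fun v _ => PureTensor.hasCompactSupport_loc hT'.isUnramified hT'.isFinSmooth v),
    ⟨T', hT', rfl⟩, T, T', hf'T, rfl, fun v hv _ => hloc v hv⟩

end Partner

/-- **The rank-2 letter's transfer pins are SATISFIABLE** — twin of ★ `exists_psi_globalTransferAway_satisfiable` (rank 3): for `H ∈ M₂(L)`
hermitian with `det H ≠ 0`, with `S` (`= T`), `ψ` off `S` and `S₀ ⊇ S` of `exists_psiOff_conj_forall_levelMatching_two`, smooth `f′ ≠ 0`
exist (★ `exists_compactlySupported_isTest_ne_zero`) and every smooth `f′` on `U(H)(𝔸)` has a smooth partner `f` on `U(Φ₂)(𝔸)` with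
`GlobalTransferAwayOff S ψ S₀ f′ f`. [cite: Rogawski1990, §14.2 p. 233] -/
theorem exists_psiOff_globalTransferAwayOff_satisfiable_two (H : Matrix (Fin 2) (Fin 2) L)
    (hH : (H.map (cmConjRingHom L))ᵀ = H) (hHd : H.det ≠ 0) {δ : L} (hcδ : IsCMField.complexConj L δ = -δ) (hδ : δ ≠ 0) :
    ∃ (S : Finset (HeightOneSpectrum (𝓞 ↥(maximalRealSubfield L))))
      (ψ : ∀ v : HeightOneSpectrum (𝓞 ↥(maximalRealSubfield L)), v ∉ S → ((cmDatum L 2 H).Local v ≃ₜ*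
        (cmDatum L 2 (Matrix.of fun i j : Fin 2 => if i.val + j.val + 1 = 2 then (1 : L) else 0)).Local v))
      (S₀ : Finset (HeightOneSpectrum (𝓞 ↥(maximalRealSubfield L)))),
      (∀ v, v ∈ S ↔ ¬ Liu2021.LemD1.IsIsotropic (Liu2021.LemD1OfPlace.standingData L v (IsCMField.complexConj L) 2 H hcδ hδ le_rfl
        ((map_cmConjRingHom_eq_map_complexConj L H) ▸ hH) hHd)) ∧ S ⊆ S₀ ∧
      (∀ v (hv : v ∉ S), v ∉ S₀ → ∀ g,
        ψ v hv g ∈ cmLocalIntegralLevel L 2 (Matrix.of fun i j : Fin 2 => if i.val + j.val + 1 = 2 then (1 : L) else 0) v ↔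
          g ∈ cmLocalIntegralLevel L 2 H v) ∧
      (∃ f' : CompactlySupportedContinuousMap (cmDatum L 2 H).Adelic ℂ,
        (∃ T : PureTensor L 2 H, T.IsTest ∧ ⇑f' = T.eval) ∧ f' ≠ 0) ∧
      ∀ f' : CompactlySupportedContinuousMap (cmDatum L 2 H).Adelic ℂ, (∃ T : PureTensor L 2 H, T.IsTest ∧ ⇑f' = T.eval) →
        ∃ f : CompactlySupportedContinuousMap
            (cmDatum L 2 (Matrix.of fun i j : Fin 2 => if i.val + j.val + 1 = 2 then (1 : L) else 0)).Adelic ℂ,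
          (∃ T' : PureTensor L 2 (Matrix.of fun i j : Fin 2 => if i.val + j.val + 1 = 2 then (1 : L) else 0),
            T'.IsTest ∧ ⇑f = T'.eval) ∧ GlobalTransferAwayOff L 2 S ψ S₀ f' f := by
  obtain ⟨S, ψ, S₀, hS, hSS₀, -, -, -, hlev⟩ := exists_psiOff_conj_forall_levelMatching_two L H hH hHd hcδ hδ
  obtain ⟨f', hf', -, hf'0⟩ := exists_compactlySupported_isTest_ne_zero L 2 H
  exact ⟨S, ψ, S₀, hS, hSS₀, hlev, ⟨f', hf', hf'0⟩, fun g hg => exists_smooth_globalTransferAwayOff_of_smooth L 2 S ψ S₀ hlev g hg⟩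

end Literature.NumberTheory.Automorphic.UnitaryGroup

end
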